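import Mathlib
import Literature.Analysis.FluidPDE.TypeIAncientMild
import Literature.Analysis.FluidPDE.OseenSlice
import Literature.Analysis.FluidPDE.OseenDuhamelPairCalculus
import Literature.Analysis.FluidPDE.MildSolutionProofs
import Literature.Analysis.FluidPDE.AncientMildDrift
import Summits.NavierStokesRegularity.NavierStokesRegularity.Theorems.SymmetryModuliCountSymmetricLiouvilleSmallAtMinusInfinity
import Summits.NavierStokesRegularity.NavierStokesRegularity.Theorems.SymmetryModuliCountSymmetricLiouville
import Summits.NavierStokesRegularity.NavierStokesRegularity.Theorems.SymmetryModuliCountSymmetricLiouvilleRotationCovariance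
import Summits.NavierStokesRegularity.NavierStokesRegularity.Theorems.DssFarFieldSlavingBlowupTypeIDssProfileSimilarityEnstrophyTimeOnlyThreshold
import HarnessLib
import Summits.NavierStokesRegularity.NavierStokesRegularity.Theorems.ScenarioCensusRoughnessMeterRows
import Summits.NavierStokesRegularity.NavierStokesRegularity.Theorems.ScenarioCensusDeviatorMeterStress

/-!
# Census block A2 (amplitude / symmetry meters), cells A2np / A2pe / A2pd (head) / A2pc / A2pb / A2ai (DECIDED), A2pm (OPEN) — instrument «PARITY METER», LINE «parity-meter» port,
# part 1/3: §A the constants (kernel constant BY NAME from the roughness-meter port, the parity weight, the parity constant, the universal threshold), §B the lever —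
# the sign asymmetry of the quadratic term (`kernel_polarisation`, `slice_pair_bound`)

Re-homed for the scenario census (typer seat ns-census-typer-1 g9; the cells A2np / A2pe / A2pd / A2pc / A2pb / A2ai are MEMBERS OF RECORD «DECIDED IN KERNEL IN FILES»
of block A2 since census v1.77 (critic idea-crit-3 PASS 02:53Z; ref ns-census-ref g10 PRE-CHECK ✓ §15.18 item 42; lead-presearch label); this port makes them
TREE-decided): VERBATIM PORT of ns-idea-2 LINE «parity-meter», `pub/ideators/ns-idea-2/lines/parity-meter/line-parity-meter.lean` sha16 d578da454eaab7e9 (775 l.,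
lean check rc 0, 0 sorry), split for the 400-line rule into `ScenarioCensusParityMeter` (§A–§B) → `…ParityMeterWindow` (§C–§D) → `…ParityMeterRows` (§E–§G +
census KEYS).  Lean text VERBATIM in namespace `…Theorems.ScenarioCensus.ParityMeter` (the line's `…Lines.ParityMeter` re-homed); port edits: `local notation
"E3"` → `abbrev E3` (typer lint: no notation in port files), `@[conjecture]` on the OPEN row `Row_A2pm` (typed only), eight one-line docstrings added (gate lint);
the constant `kernelConst` (+ `_pos` / `_spec`), the two `rpow` window integrals, `one_div_sqrt_two_lt_one` and the roughness head `Row_A2os`, which the line shares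
VERBATIM with the landed roughness-meter / deviator-meter ports, are taken BY NAME (listed below).  Statements untouched.

No census VALUE is moved here (the cells become TREE-decided by name; booking is the lead's); NS regularity is NOT proved; (L′) ⟨10661⟩ is untouched; no
summit statement is proved by this file. Lemmas that restate already-landed tree declarations are taken BY NAME (gate lint `dedup.landed`): `kernelConst` = `RoughnessMeter.kernelConst`, `kernelConst_pos` = `RoughnessMeter.kernelConst_pos`, `kernelConst_spec` = `RoughnessMeter.kernelConst_spec`, `integrableOn_sub_rpow` = `RoughnessMeter.integrableOn_sub_rpow`, `setIntegral_sub_rpow` = `RoughnessMeter.setIntegral_sub_rpow`, `one_div_sqrt_two_lt_one` = `DeviatorMeter.one_div_sqrt_two_lt_one`, `Row_A2os` = `RoughnessMeter.Row_A2os`.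
-/

-- the summit and its single problem share the name `NavierStokesRegularity` (D-0017 nested layout)
set_option linter.dupNamespace false

noncomputable section

open Set Function Filter Topology Metric MeasureTheory

namespace Summit.NavierStokesRegularity.NavierStokesRegularity.Theorems.ScenarioCensus.ParityMeter

open Literature.Analysis Literature.Analysis.FluidPDE
open Summit.NavierStokesRegularity.NavierStokesRegularity.Theorems.SimilarityEnstrophy
  (typeI_ancient_eq_zero_of_rate_lt_one)
open Summit.NavierStokesRegularity.NavierStokesRegularity.Theorems.SymmetryModuliCountSymmetricLiouville
  (vanishes_of_vanishes_before isTypeIAncientMild_comp_add_right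
    isTypeIAncientMild_conj_linearIsometryEquiv)

/-- `ℝ³` (the line's `local notation "E3"`, spelled as a reducible abbreviation for the tree). -/
abbrev E3 := EuclideanSpace ℝ (Fin 3)

/-! ## A. Constants: the kernel constant, the parity weight, the parity constant -/

-- `kernel_bound_three`: the kernel bound is used only through `kernelConst` (taken BY NAME from the roughness-meter port, where it is the Literature lemma `exists_norm_oseenKernel_three_le`); not re-declared.

-- `kernelConst`: the line restates the tree's `RoughnessMeter.kernelConst`; taken BY NAME (gate lint dedup.landed).

-- `kernelConst_pos`: the line restates the tree's `RoughnessMeter.kernelConst_pos`; taken BY NAME (gate lint dedup.landed).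

-- `kernelConst_spec`: the line restates the tree's `RoughnessMeter.kernelConst_spec`; taken BY NAME (gate lint dedup.landed).

/-- The **parity weight** `I_P = ∫_{ℝ³} (1 + ‖w‖²)^{-2} dw` (`= π²`): the unit-scale mass of the
kernel majorant. -/
def parityWeight : ℝ := ∫ w : E3, (1 + ‖w‖ ^ 2) ^ (-(2 : ℝ))

/-- The parity weight is positive. -/
theorem parityWeight_pos : 0 < parityWeight := by
  unfold parityWeight
  refine integral_one_add_norm_sq_rpow_neg_pos (E := E3) ?_
  rw [finrank_euclideanSpace_fin]; norm_num

/-- The **parity constant** `K_P = 2 C_K I_P`: the factor in the one-window bound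
`√(-t) ‖½(u - w)(t)‖ ≤ M/√2 + K_P · η · M` (`pair_step`). -/
def parityConst : ℝ := 2 * RoughnessMeter.kernelConst * parityWeight

/-- The parity constant is positive. -/
theorem parityConst_pos : 0 < parityConst := by
  unfold parityConst
  have := RoughnessMeter.kernelConst_pos
  have := parityWeight_pos
  positivity

/-- The **universal threshold** `η₀ = min 1 ((1 - 1/√2) / (2 K_P))`. -/
def parityThreshold : ℝ := min 1 ((1 - 1 / Real.sqrt 2) / (2 * parityConst))

-- `one_div_sqrt_two_lt_one`: the line restates the tree's `DeviatorMeter.one_div_sqrt_two_lt_one`; taken BY NAME (gate lint dedup.landed).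

/-- The universal threshold is positive. -/
theorem parityThreshold_pos : 0 < parityThreshold := by
  unfold parityThreshold
  have h1 := DeviatorMeter.one_div_sqrt_two_lt_one
  have h2 := parityConst_pos
  refine lt_min one_pos ?_
  apply div_pos <;> linarith

/-- The universal threshold is at most one. -/
theorem parityThreshold_le_one : parityThreshold ≤ 1 := min_le_left _ _

/-- The contraction inequality `1/√2 + K_P·η₀ < 1`. -/
theorem parityThreshold_contracts : 1 / Real.sqrt 2 + parityConst * parityThreshold < 1 := by
  have h1 := DeviatorMeter.one_div_sqrt_two_lt_one
  have h2 := parityConst_pos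
  have h3 : parityThreshold ≤ (1 - 1 / Real.sqrt 2) / (2 * parityConst) := min_le_right _ _
  have h4 : parityConst * parityThreshold ≤ parityConst * ((1 - 1 / Real.sqrt 2) / (2 * parityConst)) :=
    mul_le_mul_of_nonneg_left h3 h2.le
  have e : parityConst * ((1 - 1 / Real.sqrt 2) / (2 * parityConst)) = (1 - 1 / Real.sqrt 2) / 2 := by
    field_simp
  rw [e] at h4
  linarith

/-! ## B. The lever: the sign asymmetry of the quadratic term

`u ↦ -u` is NOT a symmetry of Navier–Stokes: if `w` solves the Oseen integral equation then `-w`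
solves it with the opposite sign of the Duhamel term.  Consequently the HALF-DIFFERENCE
`e = ½(u - w)` of two solutions obeys `e(t) = e^{(t-s)Δ}e(s) - ½[B(u - w, ½(u + w)) + B(½(u + w), u - w)]`
— the forcing is LINEAR in `e` with coefficient the SUM `u + w`.  When the sum is small the
half-difference contracts to zero. -/

/-- Pointwise polarisation: `K[a, a] - K[b, b] = K[a - b, ½(a + b)] + K[½(a + b), a - b]`. -/
theorem kernel_polarisation (σ : ℝ) (z a b : E3) :
    oseenKernel σ z a a - oseenKernel σ z b b =
      oseenKernel σ z (a - b) ((1 / 2 : ℝ) • (a + b)) +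
        oseenKernel σ z ((1 / 2 : ℝ) • (a + b)) (a - b) := by
  simp only [oseenKernel_sub_left, oseenKernel_sub_right, oseenKernel_add_left,
    oseenKernel_add_right, oseenKernel_smul_left, oseenKernel_smul_right]
  module

/-- **Slice pair bound (the engine's kernel estimate).**  For continuous bounded slices `f, g`
with `‖f - g‖ ≤ 2A` and `‖f + g‖ ≤ D` pointwise, the Oseen slices at lag `σ > 0` obey
`‖N_σ[f, f](x) - N_σ[g, g](x)‖ ≤ 2 C_K I_P · A · D · σ^{-1/2}`. -/
theorem slice_pair_bound {σ : ℝ} (hσ : 0 < σ) {f g : E3 → E3} (hfc : Continuous f)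
    (hgc : Continuous g) {A D Mf Mg : ℝ} (hA0 : 0 ≤ A) (hD0 : 0 ≤ D)
    (hMf : ∀ y, ‖f y‖ ≤ Mf) (hMg : ∀ y, ‖g y‖ ≤ Mg)
    (hA : ∀ y, ‖f y - g y‖ ≤ 2 * A) (hD : ∀ y, ‖f y + g y‖ ≤ D) (x : E3) :
    ‖oseenSlice σ f f x - oseenSlice σ g g x‖ ≤
      2 * RoughnessMeter.kernelConst * parityWeight * A * D * σ ^ (-(1 : ℝ) / 2) := by
  have hf : Integrable (fun y => oseenKernel σ (x - y) (f y) (f y)) :=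
    integrable_oseenKernel_slice_of_bound hσ hfc.aestronglyMeasurable hfc.aestronglyMeasurable
      hMf hMf x
  have hg : Integrable (fun y => oseenKernel σ (x - y) (g y) (g y)) :=
    integrable_oseenKernel_slice_of_bound hσ hgc.aestronglyMeasurable hgc.aestronglyMeasurable
      hMg hMg x
  rw [oseenSlice_apply, oseenSlice_apply, ← integral_sub hf hg]
  have he : (Module.finrank ℝ E3 : ℝ) < 2 * 2 := by
    rw [finrank_euclideanSpace_fin]; norm_num
  have hw : Integrable (fun z : E3 => (σ + ‖z‖ ^ 2) ^ (-(2 : ℝ))) :=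
    integrable_add_norm_sq_rpow_neg he hσ
  have hwx : Integrable (fun y : E3 => (σ + ‖x - y‖ ^ 2) ^ (-(2 : ℝ))) := hw.comp_sub_left x
  have hCK := RoughnessMeter.kernelConst_pos
  have hbound : ∀ y, ‖oseenKernel σ (x - y) (f y) (f y) - oseenKernel σ (x - y) (g y) (g y)‖ ≤
      2 * RoughnessMeter.kernelConst * A * D * (σ + ‖x - y‖ ^ 2) ^ (-(2 : ℝ)) := by
    intro y
    rw [kernel_polarisation]
    have hwnn : 0 ≤ (σ + ‖x - y‖ ^ 2) ^ (-(2 : ℝ)) := Real.rpow_nonneg (by positivity) _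
    have hm : ‖(1 / 2 : ℝ) • (f y + g y)‖ ≤ D / 2 := by
      rw [norm_smul, Real.norm_of_nonneg (by norm_num : (0:ℝ) ≤ 1 / 2)]
      have := hD y
      linarith
    have h1 : ‖oseenKernel σ (x - y) (f y - g y) ((1 / 2 : ℝ) • (f y + g y))‖ ≤
        RoughnessMeter.kernelConst * (σ + ‖x - y‖ ^ 2) ^ (-(2 : ℝ)) * (2 * A) * (D / 2) := by
      refine (RoughnessMeter.kernelConst_spec hσ _ _ _).trans ?_
      gcongr
      · exact hA y
    have h2 : ‖oseenKernel σ (x - y) ((1 / 2 : ℝ) • (f y + g y)) (f y - g y)‖ ≤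
        RoughnessMeter.kernelConst * (σ + ‖x - y‖ ^ 2) ^ (-(2 : ℝ)) * (D / 2) * (2 * A) := by
      refine (RoughnessMeter.kernelConst_spec hσ _ _ _).trans ?_
      gcongr
      · exact hA y
    calc ‖oseenKernel σ (x - y) (f y - g y) ((1 / 2 : ℝ) • (f y + g y)) +
          oseenKernel σ (x - y) ((1 / 2 : ℝ) • (f y + g y)) (f y - g y)‖
        ≤ RoughnessMeter.kernelConst * (σ + ‖x - y‖ ^ 2) ^ (-(2 : ℝ)) * (2 * A) * (D / 2) +
          RoughnessMeter.kernelConst * (σ + ‖x - y‖ ^ 2) ^ (-(2 : ℝ)) * (D / 2) * (2 * A) :=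
          (norm_add_le _ _).trans (add_le_add h1 h2)
      _ = 2 * RoughnessMeter.kernelConst * A * D * (σ + ‖x - y‖ ^ 2) ^ (-(2 : ℝ)) := by ring
  refine (norm_integral_le_of_norm_le (hwx.const_mul (2 * RoughnessMeter.kernelConst * A * D))
    (Eventually.of_forall hbound)).trans ?_
  rw [MeasureTheory.integral_const_mul]
  have hsub : ∫ y : E3, (σ + ‖x - y‖ ^ 2) ^ (-(2 : ℝ)) = ∫ z : E3, (σ + ‖z‖ ^ 2) ^ (-(2 : ℝ)) :=
    integral_sub_left_eq_self (fun z : E3 => (σ + ‖z‖ ^ 2) ^ (-(2 : ℝ))) volume x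
  rw [hsub, integral_add_norm_sq_rpow_neg hσ 2, finrank_euclideanSpace_fin]
  have e : ((3 : ℕ) : ℝ) / 2 - 2 = -(1 : ℝ) / 2 := by push_cast; ring
  rw [e]
  unfold parityWeight
  apply le_of_eq
  ring

end Summit.NavierStokesRegularity.NavierStokesRegularity.Theorems.ScenarioCensus.ParityMeter

end
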